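import Mathlib
import HarnessLib
import Summits.QuantumAdvantage.QuantumAdvantage.Theses.AmplitudeProofs
import Literature.Computability.MetaComplexity.ProofSystemsProofs
import Literature.Computability.Complexity.ReductionsProofs
import Literature.Computability.Complexity.BrickAlgebra
import Literature.Computability.Complexity.Promise
import Literature.Computability.Cryptography.ClassBQP

/-!
# Crux `ApcThesis` (stmt-QuantumAdvantage-2697) — line `np-cut` ("cut along NP"; strategist, BC2 redirect)

`ApcThesis` (the negation-side frame X_P of route AmplitudeProofs: a sound polynomial-time amplitude verifier
that is polynomially bounded AND automatizable on the BQP promise = PromiseBQP ⊆ PromiseP in Cook–Reckhow form)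
is cut along the field's own seam *p-bounded* / *automatizable*:

* `stub_polyBounded`  (piece X₁ `ApcPolyBounded`, crux): the Cook–Reckhow form of `PromiseBQP ⊆ PromiseNP` —
  a sound poly-time verifier whose proofs are polynomially SHORT on the `2/3`-promise (no finder);
* `stub_certifiedCollapse` (piece X₂ `ApcCertifiedCollapse`, crux): `PromiseBQP ∩ PromiseNP ⊆ PromiseP` —
  no quantum advantage on NP-certifiable promise problems (the automatizability half, stated class-theoretically so
  that it does NOT hand back a finder for the given verifier: the glue must change the verifier);
* `stub_universal` (piece X₃ `ApcUniversal`, support, true): a universal gap-preserving uniform oracle-free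
  Clifford+T family on instance codes `⟨⟨C⟩, x⟩` (puts the gap-acceptance promise problem in `PromiseBQP`).

Composition `ApcThesis_of : ApcThesis` (kernel-checked, uses the three stubs by name; no sorry outside the stubs; ~60 lines with its two lemmas): Cook–Reckhow Prop. 1.4 pattern —
the language of short `V`-proofs is in `NP` (re-pairing machine `polyTimeComputable_boolUnpair`, `LenLe`-free since
the length bound sits in the existential), so the gap-acceptance promise problem `apcPromise` is in
`PromiseBQP ∩ PromiseNP`, hence in `PromiseP` by X₂ with a separator `D ∈ P`; the new verifier ignores its proof and
decides `D` on the first component (`preimage_mem_P`, `Brick.fstF_mem_FP`), the finder is the constant `[]`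
(`const_mem_FP`). Sources: CookReckhow1979 §1 Prop. 1.4; Watrous2009 §III.2; Goldreich2006 Def. 1.2–1.3.
-/

set_option linter.dupNamespace false

namespace Summit.QuantumAdvantage.QuantumAdvantage.Cruxes.ApcThesis.NpCut

open _root_.Computability Literature.Computability.Complexity Literature.Computability.Complexity.Classes
  Literature.Computability.Complexity.Nondeterministic Literature.Computability.MetaComplexity
  Literature.Computability.Cryptography
open Summit.QuantumAdvantage.QuantumAdvantage.Theses.AmplitudeProofs

/-! ### Registered stubs = the pieces of the split (inlined; they become route decls after `route edit --split`) -/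

/-- **stub (piece X₃, support, TRUE in print: universal quantum circuit, Nielsen–Chuang §4.5 + exact Clifford+T
synthesis of the controlled gadgets, Giles–Selinger arXiv:1212.0506).** A universal gap-preserving uniform
oracle-free Clifford+T family on instance codes. -/
theorem stub_universal : ∃ U : Literature.Computability.Cryptography.QCircuitFamily Literature.Computability.Cryptography.cliffordT, U.IsOracleFree ∧ U.IsUniform ∧ ∀ (n m : ℕ) (C : Literature.Computability.Cryptography.QCircuit Literature.Computability.Cryptography.cliffordT (n + m)) (x : Literature.Computability.Cryptography.QReg n), C.IsOracleFree → ((2 : ℝ) / 3 ≤ C.acceptProb 0 x → (2 : ℝ) / 3 ≤ U.acceptProbOn 0 (Literature.Computability.Complexity.boolPair (Literature.Computability.Cryptography.QCircuit.sigmaEncode ⟨n, m, C⟩) (List.ofFn x))) ∧ (C.acceptProb 0 x ≤ (1 : ℝ) / 3 → U.acceptProbOn 0 (Literature.Computability.Complexity.boolPair (Literature.Computability.Cryptography.QCircuit.sigmaEncode ⟨n, m, C⟩) (List.ofFn x)) ≤ (1 : ℝ) / 3) := by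
  sorry

/-- **stub (piece X₁, crux, OPEN — `PromiseBQP ⊆ PromiseNP` in Cook–Reckhow form; expected false by many,
cf. Raz–Tal 2019 oracle `BQP ⊄ PH`).** Sound poly-time amplitude verifier with polynomially short proofs on the
`2/3`-promise. -/
theorem stub_polyBounded : ∃ V : List Bool → List Bool → Bool, Literature.Computability.MetaComplexity.IsPolyTimeVerifier V ∧ (∀ (n m : ℕ) (C : Literature.Computability.Cryptography.QCircuit Literature.Computability.Cryptography.cliffordT (n + m)) (x : Literature.Computability.Cryptography.QReg n) (π : List Bool), C.IsOracleFree → V (Literature.Computability.Complexity.boolPair (Literature.Computability.Cryptography.QCircuit.sigmaEncode ⟨n, m, C⟩) (List.ofFn x)) π = true → (1 : ℝ) / 3 < C.acceptProb 0 x) ∧ ∃ p : Polynomial ℕ, ∀ (n m : ℕ) (C : Literature.Computability.Cryptography.QCircuit Literature.Computability.Cryptography.cliffordT (n + m)) (x : Literature.Computability.Cryptography.QReg n), C.IsOracleFree → (2 : ℝ) / 3 ≤ C.acceptProb 0 x → ∃ π : List Bool, π.length ≤ p.eval (Literature.Computability.Complexity.boolPair (Literature.Computability.Cryptography.QCircuit.sigmaEncode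 ⟨n, m, C⟩) (List.ofFn x)).length ∧ V (Literature.Computability.Complexity.boolPair (Literature.Computability.Cryptography.QCircuit.sigmaEncode ⟨n, m, C⟩) (List.ofFn x)) π = true := by
  sorry

/-- **stub (piece X₂, crux, OPEN — expected false: Shor puts factoring-type promise problems in
`PromiseBQP ∩ PromiseNP`).** No quantum advantage on NP-certifiable promise problems. -/
theorem stub_certifiedCollapse : Literature.Computability.Cryptography.PromiseBQP ∩ Literature.Computability.Complexity.PromiseNP ⊆ Literature.Computability.Complexity.PromiseP := by
  sorry

/-! ### Local names for the three statements (definitionally the stub statements) -/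

/-- piece X₁ (local name). -/
def ApcPolyBounded : Prop := ∃ V : List Bool → List Bool → Bool, Literature.Computability.MetaComplexity.IsPolyTimeVerifier V ∧ (∀ (n m : ℕ) (C : Literature.Computability.Cryptography.QCircuit Literature.Computability.Cryptography.cliffordT (n + m)) (x : Literature.Computability.Cryptography.QReg n) (π : List Bool), C.IsOracleFree → V (Literature.Computability.Complexity.boolPair (Literature.Computability.Cryptography.QCircuit.sigmaEncode ⟨n, m, C⟩) (List.ofFn x)) π = true → (1 : ℝ) / 3 < C.acceptProb 0 x) ∧ ∃ p : Polynomial ℕ, ∀ (n m : ℕ) (C : Literature.Computability.Cryptography.QCircuit Literature.Computability.Cryptography.cliffordT (n + m)) (x : Literature.Computability.Cryptography.QReg n), C.IsOracleFree → (2 : ℝ) / 3 ≤ C.acceptProb 0 x → ∃ π : List Bool, π.length ≤ p.eval (Literature.Computability.Complexity.boolPair (Literature.Computability.Cryptography.QCircuit.sigmaEncode ⟨n, m, C⟩) (List.ofFn x)).length ∧ V (Literature.Computability.Complexity.boolPair (Literature.Computability.Cryptography.QCircuit.sigmaEncode ⟨n, m, C⟩) (List.ofFn x)) π = true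

/-- piece X₂ (local name). -/
def ApcCertifiedCollapse : Prop := Literature.Computability.Cryptography.PromiseBQP ∩ Literature.Computability.Complexity.PromiseNP ⊆ Literature.Computability.Complexity.PromiseP

/-- piece X₃ (local name). -/
def ApcUniversal : Prop := ∃ U : Literature.Computability.Cryptography.QCircuitFamily Literature.Computability.Cryptography.cliffordT, U.IsOracleFree ∧ U.IsUniform ∧ ∀ (n m : ℕ) (C : Literature.Computability.Cryptography.QCircuit Literature.Computability.Cryptography.cliffordT (n + m)) (x : Literature.Computability.Cryptography.QReg n), C.IsOracleFree → ((2 : ℝ) / 3 ≤ C.acceptProb 0 x → (2 : ℝ) / 3 ≤ U.acceptProbOn 0 (Literature.Computability.Complexity.boolPair (Literature.Computability.Cryptography.QCircuit.sigmaEncode ⟨n, m, C⟩) (List.ofFn x))) ∧ (C.acceptProb 0 x ≤ (1 : ℝ) / 3 → U.acceptProbOn 0 (Literature.Computability.Complexity.boolPair (Literature.Computability.Cryptography.QCircuit.sigmaEncode ⟨n, m, C⟩) (List.ofFn x)) ≤ (1 : ℝ) / 3)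

/-- The gap-acceptance promise problem of oracle-free Clifford+T circuits (instances `⟨⟨n,m,C⟩, x⟩`):
yes = acceptance `≥ 2/3`, no = acceptance `≤ 1/3`. -/
def apcPromise : PromiseProblem where
  yes := {s | ∃ (n m : ℕ) (C : QCircuit cliffordT (n + m)) (x : QReg n), C.IsOracleFree ∧
    s = boolPair (QCircuit.sigmaEncode ⟨n, m, C⟩) (List.ofFn x) ∧ (2 : ℝ) / 3 ≤ C.acceptProb 0 x}
  no := {s | ∃ (n m : ℕ) (C : QCircuit cliffordT (n + m)) (x : QReg n), C.IsOracleFree ∧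
    s = boolPair (QCircuit.sigmaEncode ⟨n, m, C⟩) (List.ofFn x) ∧ C.acceptProb 0 x ≤ (1 : ℝ) / 3}

/-- The universal family puts the gap-acceptance promise problem in `PromiseBQP`. -/
theorem apcPromise_mem_PromiseBQP (hU : ApcUniversal) : apcPromise ∈ PromiseBQP := by
  obtain ⟨U, hUo, hUu, hU⟩ := hU
  refine ⟨U, hUo, hUu, ?_, ?_⟩
  · rintro s ⟨n, m, C, x, hC, rfl, h⟩
    exact (hU n m C x hC).1 h
  · rintro s ⟨n, m, C, x, hC, rfl, h⟩
    exact (hU n m C x hC).2 h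

/-- Cook–Reckhow (Prop. 1.4 pattern): a sound, polynomially bounded amplitude proof system puts the gap-acceptance
promise problem in `PromiseNP` — the separating `NP` language is "`s` has a `V`-proof of length `≤ p |s|`". -/
theorem apcPromise_mem_PromiseNP (h : ApcPolyBounded) : apcPromise ∈ PromiseNP := by
  obtain ⟨V, hV, hsound, p, hcomplete⟩ := h
  -- the witness language of `V`, in `P` by composing the machine of `V` after the re-pairing machine
  set L' : Language Bool := {w | Function.uncurry V (boolUnpair w) = true} with hL'
  have hL'P : L' ∈ P := by
    refine mem_P_iff_holds.2 (polyTimeDecidable_iff.2 ?_)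
    have hcomp : PolyTimeComputable (id : List Bool → List Bool) encodeBool
        (Function.uncurry V ∘ boolUnpair) :=
      PolyTimeComputable.comp_holds hV polyTimeComputable_boolUnpair
    have hind : L'.boolIndicator = Function.uncurry V ∘ boolUnpair := by
      funext w
      by_cases hw : Function.uncurry V (boolUnpair w) = true
      · rw [(Set.mem_iff_boolIndicator L' w).1 hw]
        exact hw.symm
      · rw [(Set.notMem_iff_boolIndicator L' w).1 hw]
        simp only [Function.comp_apply]
        cases h : Function.uncurry V (boolUnpair w)
        · rfl
        · exact absurd h hw
    rw [hind]
    exact hcomp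
  have hmem : ∀ s π : List Bool, boolPair s π ∈ L' ↔ V s π = true := fun s π => by
    change Function.uncurry V (boolUnpair (boolPair s π)) = true ↔ _
    rw [boolUnpair_boolPair]
    rfl
  -- the NP language of short proofs
  set L₁ : Language Bool := {s | ∃ π : List Bool, π.length ≤ p.eval s.length ∧ V s π = true} with hL₁
  have hL₁NP : L₁ ∈ NP := by
    refine ⟨L', hL'P, p, fun s => ?_⟩
    change (∃ π : List Bool, π.length ≤ p.eval s.length ∧ V s π = true) ↔ _
    simp only [hmem]
  refine ⟨L₁, hL₁NP, ?_, ?_⟩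
  · rintro s ⟨n, m, C, x, hC, rfl, hacc⟩
    exact hcomplete n m C x hC hacc
  · rintro s ⟨n, m, C, x, hC, rfl, hacc⟩ ⟨π, -, hπ⟩
    have := hsound n m C x π hC hπ
    linarith

/-- **Composition of the line = glue of the split** (kernel-checked, sorry-free outside the stubs): the crux
`ApcThesis` BY NAME from the three registered stubs `stub_universal`, `stub_polyBounded`, `stub_certifiedCollapse`
("cut along NP": `PromiseBQP ∩ PromiseNP ⊆ PromiseP` applied to the gap-acceptance promise problem, which the other
two stubs place in `PromiseBQP ∩ PromiseNP`; the new verifier decides the `P`-separator and ignores its proof). -/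
theorem ApcThesis_of : Summit.QuantumAdvantage.QuantumAdvantage.Theses.AmplitudeProofs.ApcThesis := by
  have hU : ApcUniversal := stub_universal
  have h₁ : ApcPolyBounded := stub_polyBounded
  have h₂ : ApcCertifiedCollapse := stub_certifiedCollapse
  -- the promise problem is in PromiseBQP ∩ PromiseNP, hence in PromiseP
  obtain ⟨D, hDP, hyes, hno⟩ := h₂ ⟨apcPromise_mem_PromiseBQP hU, apcPromise_mem_PromiseNP h₁⟩
  -- the pair language `{⟨s, π⟩ | s ∈ D}` is in `P` (preimage of `D` under the first projection)
  set W : Language Bool := Brick.fstF ⁻¹' D with hW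
  have hWP : W ∈ P := preimage_mem_P hDP Brick.fstF_mem_FP
  have hmemW : ∀ s π : List Bool, boolPair s π ∈ W ↔ s ∈ D := fun s π => by
    change Brick.fstF (boolPair s π) ∈ D ↔ s ∈ D
    rw [Brick.fstF_boolPair]
  obtain ⟨q, M, hM⟩ := polyTimeDecidable_iff.1 (mem_P_iff_holds.1 hWP)
  -- the verifier ignores its proof and decides `D`; the finder outputs the empty proof
  refine ⟨fun s π => W.boolIndicator (boolPair s π), fun _ => [],
    ⟨q, M, fun pr => hM (boolPair pr.1 pr.2)⟩, const_mem_FP [], ?_, ?_⟩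
  · intro n m C x π hC hVtrue
    have hsD := (hmemW _ π).1 ((Set.mem_iff_boolIndicator W _).2 hVtrue)
    by_contra hle
    exact hno ⟨n, m, C, x, hC, rfl, not_lt.1 hle⟩ hsD
  · intro n m C x hC hacc
    have hsD := hyes ⟨n, m, C, x, hC, rfl, hacc⟩
    exact (Set.mem_iff_boolIndicator W _).1 ((hmemW _ []).2 hsD)


end Summit.QuantumAdvantage.QuantumAdvantage.Cruxes.ApcThesis.NpCut
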